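import Summits.CriticalPhenomena.PercolationContinuityZ3.Theorems.PercNearOneGluingNoHeavyLowerTailGuardedLonelyRelay
import Literature.Probability.Percolation.TwoSetConditionalAssociation
import Literature.Probability.Percolation.LonelyClusterExchange
import HarnessLib

/-!
# `NoHeavyLowerTail` (stmt-CriticalPhenomena-4575) — the upward-transport comparison `UT` for an
# observer glued to a SET OF RELAYS (set form of the exchange face)

Lemma factory #6 (`prim-lf-6`, gen 4, observer-set technique), 2026-08-19.  `μ = prodBernoulli w` on a finite
vertex type `V`, relays `A`, level `j`, `π(v) = {z ∈ A : v ↔ z}`, `R_v = {|π(v)| ≤ j}`; for a set `B` of relays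
`C_B = ⋃_{b ∈ B} C_b` (union of the van den Berg–Häggström–Kahn open edge clusters), `π(B) = ⋃_{b∈B} π(b)`,
`D_B = {B ↮ c}`.

`UpwardTransport.relaySet_transport` — for `∅ ≠ B ⊆ A`, a vertex `c`, a relay `y ∈ B` that is at least as
lonely as `c` (`μ(R_y) ≤ μ(R_c)`) and ANY monotone predicate `P` of edge sets:

    `μ(P(C_B), B ↮ c, |π(c)| > j) ≤ μ(P(C_B), B ↮ c, |π(B)| > j)`.

This is the monotone-coupling ("upward transport", memo `run/shared/lean/prim/prim-lf-6/UT-MEMO.md`) comparison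
for the observer SET `B`: given that `B` misses `c`, "the relay set `B` sees an increasing event and `c` is heavy"
is rarer than "the relay set `B` sees the same event and is itself heavy".  For `B = {x}` it is the exchange face
`UpwardTransport.upset_within_relay` (file `…UpwardTransport.lean`); for `P ≡ ⊤` it is the observer-set transfer
`observerSet_le_of_lonelier` (BHK 2006 Thm 1.5) in T-form.  Proof: three applications of the SET form of van den
Berg–Häggström–Kahn's Theorem 1.5 (`setClusterEventExchange`: negative correlation of `P(C_B)` with `{|π(c)| > j}`
given `D_B`, positive correlation of `P(C_B)` with `{|π(B)| > j}` given `D_B`) around the set champion row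
`μ(D_B, |π(c)| > j) ≤ μ(D_B, |π(B)| > j)` (`observerSet_le_of_lonelier`).  It is the `G ∖ {o}` core of the
one-layer case of UT (star decomposition over the open ports `B` of a one-layer observer `o`; sequel file).
No definitions, no named facts, no sorries.
-/

noncomputable section

namespace Summit.CriticalPhenomena.PercolationContinuityZ3.Theorems

open MeasureTheory Set Literature.Probability.LatticeModels Literature.Probability.Percolation
open scoped Classical BigOperators

namespace UpwardTransport

variable {V : Type*}

/-- Reachability from a member `b ∈ B` read on the union `C_B` of the open edge clusters of `B` is reachability in
the open graph. [folklore] -/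
theorem reachable_fromEdgeSet_biUnion_iff (ω : BondConfig V) (B : Set V) {b : V} (hb : b ∈ B) (z : V) :
    (SimpleGraph.fromEdgeSet (⋃ s ∈ B, openEdgeCluster ω s)).Reachable b z ↔ (openGraph ω).Reachable b z := by
  constructor
  · intro h
    have hsub : (⋃ s ∈ B, openEdgeCluster ω s) ⊆ ω :=
      Set.iUnion₂_subset fun s _ => openEdgeCluster_subset ω s
    exact h.mono (SimpleGraph.fromEdgeSet_mono hsub)
  · intro h
    exact (GuardedLonelyRelay.reachable_fromEdgeSet_openEdgeCluster h).mono
      (SimpleGraph.fromEdgeSet_mono (Set.subset_biUnion_of_mem hb))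

variable [Fintype V]

/-- **Upward transport for an observer glued to a relay set (set form of the exchange face).**  For a finite
vertex set `B`, a relay `y ∈ B ∩ A` at least as lonely as the vertex `c`
(`μ(R_y) ≤ μ(R_c)`) and a monotone predicate `P` of edge sets:
`μ(P(C_B) ∧ B ↮ c ∧ |π(c)| > j) ≤ μ(P(C_B) ∧ B ↮ c ∧ |π(B)| > j)`.
[cite: VandenbergHaggstromKahn2005, Thm. 2.1 (p. 9) at q = 1 / Thm. 1.5 (p. 7) — corollary via `setClusterEventExchange` and `observerSet_le_of_lonelier`; this work] -/
theorem relaySet_transport (w : Sym2 V → unitInterval) (A B : Finset V) (y c : V) (j : ℕ)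
    (hyB : y ∈ B) (hyA : y ∈ A)
    (hle : (prodBernoulli w).real {ω : BondConfig V | (A.filter fun z => ω ∈ openConn y z).card ≤ j} ≤
      (prodBernoulli w).real {ω : BondConfig V | (A.filter fun z => ω ∈ openConn c z).card ≤ j})
    (P : Set (Sym2 V) → Prop) (hP : ∀ ⦃C C' : Set (Sym2 V)⦄, C ⊆ C' → P C → P C') :
    (prodBernoulli w).real ({ω : BondConfig V | P (⋃ s ∈ (↑B : Set V), openEdgeCluster ω s)} ∩
        {ω | ∀ b ∈ B, ω ∉ (openConn b c : Set (BondConfig V))} ∩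
        {ω | j < (A.filter fun z => ω ∈ openConn c z).card}) ≤
      (prodBernoulli w).real ({ω : BondConfig V | P (⋃ s ∈ (↑B : Set V), openEdgeCluster ω s)} ∩
        {ω | ∀ b ∈ B, ω ∉ (openConn b c : Set (BondConfig V))} ∩
        {ω | j < (A.filter fun z => ∃ b ∈ B, ω ∈ (openConn b z : Set (BondConfig V))).card}) := by
  set μ := prodBernoulli w with hμ
  -- the events
  set D : Set (BondConfig V) :=
    {ω | ∀ s ∈ (↑B : Set V), ∀ t ∈ ({c} : Set V), ¬ (openGraph ω).Reachable s t} with hD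
  set E : Set (BondConfig V) := {ω | P (⋃ s ∈ (↑B : Set V), openEdgeCluster ω s)} with hE
  set Hc : Set (BondConfig V) := {ω | j < (A.filter fun z => ω ∈ openConn c z).card} with hHc
  set HB : Set (BondConfig V) :=
    {ω | j < (A.filter fun z => ∃ b ∈ B, ω ∈ (openConn b z : Set (BondConfig V))).card} with hHB
  have hDeq : {ω : BondConfig V | ∀ b ∈ B, ω ∉ (openConn b c : Set (BondConfig V))} = D := by
    ext ω
    simp only [hD, mem_setOf_eq, Finset.mem_coe, mem_singleton_iff, forall_eq]
    rfl
  -- edge-set predicates for the relay counts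
  set Qc : Set (Sym2 V) → Prop := fun C =>
    j < (A.filter fun z => ∃ b ∈ ({c} : Set V), (SimpleGraph.fromEdgeSet C).Reachable b z).card with hQc
  set QB : Set (Sym2 V) → Prop := fun C =>
    j < (A.filter fun z => ∃ b ∈ (↑B : Set V), (SimpleGraph.fromEdgeSet C).Reachable b z).card with hQB
  have hQc_mono : ∀ ⦃C C' : Set (Sym2 V)⦄, C ⊆ C' → Qc C → Qc C' := fun C C' h hC =>
    lt_of_lt_of_le hC (Finset.card_le_card (Finset.monotone_filter_right A fun z _ ⟨b, hb, hz⟩ =>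
      ⟨b, hb, hz.mono (SimpleGraph.fromEdgeSet_mono h)⟩))
  have hQB_mono : ∀ ⦃C C' : Set (Sym2 V)⦄, C ⊆ C' → QB C → QB C' := fun C C' h hC =>
    lt_of_lt_of_le hC (Finset.card_le_card (Finset.monotone_filter_right A fun z _ ⟨b, hb, hz⟩ =>
      ⟨b, hb, hz.mono (SimpleGraph.fromEdgeSet_mono h)⟩))
  have hQc_ev : {ω : BondConfig V | Qc (⋃ t ∈ ({c} : Set V), openEdgeCluster ω t)} = Hc := by
    ext ω
    simp only [hQc, hHc, mem_setOf_eq]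
    have hfc : (A.filter fun z => ∃ b ∈ ({c} : Set V),
        (SimpleGraph.fromEdgeSet (⋃ t ∈ ({c} : Set V), openEdgeCluster ω t)).Reachable b z) =
        (A.filter fun z => ω ∈ (openConn c z : Set (BondConfig V))) := by
      refine Finset.filter_congr fun z _ => ⟨?_, fun h => ⟨c, rfl, ?_⟩⟩
      · rintro ⟨b, hb, h⟩
        rw [Set.mem_singleton_iff] at hb
        subst hb
        exact (reachable_fromEdgeSet_biUnion_iff ω ({b} : Set V) rfl z).1 h
      · exact (reachable_fromEdgeSet_biUnion_iff ω ({c} : Set V) rfl z).2 h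
    rw [hfc]
  have hQB_ev : {ω : BondConfig V | QB (⋃ s ∈ (↑B : Set V), openEdgeCluster ω s)} = HB := by
    ext ω
    simp only [hQB, hHB, mem_setOf_eq]
    have hfB : (A.filter fun z => ∃ b ∈ (↑B : Set V),
        (SimpleGraph.fromEdgeSet (⋃ s ∈ (↑B : Set V), openEdgeCluster ω s)).Reachable b z) =
        (A.filter fun z => ∃ b ∈ B, ω ∈ (openConn b z : Set (BondConfig V))) := by
      refine Finset.filter_congr fun z _ => ⟨?_, ?_⟩
      · rintro ⟨b, hb, h⟩
        exact ⟨b, Finset.mem_coe.1 hb, (reachable_fromEdgeSet_biUnion_iff ω (↑B : Set V) hb z).1 h⟩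
      · rintro ⟨b, hb, h⟩
        exact ⟨b, Finset.mem_coe.2 hb,
          (reachable_fromEdgeSet_biUnion_iff ω (↑B : Set V) (Finset.mem_coe.2 hb) z).2 h⟩
    rw [hfB]
  -- (1) negative correlation of `E` (increasing in `C_B`) and `Hc` (increasing in `C_c`) given `D`
  have h1 : μ.real (D ∩ (E ∩ Hc)) * μ.real D ≤ μ.real (D ∩ E) * μ.real (D ∩ Hc) := by
    have key := setClusterEventExchange w (↑B : Set V) ({c} : Set V) P (fun _ => True) Qc (fun _ => True)
      hP (fun _ _ _ h => h) hQc_mono (fun _ _ _ h => h)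
    rw [hQc_ev] at key
    have e1 : (D ∩ ({ω : BondConfig V | (fun _ : Set (Sym2 V) => True) (⋃ s ∈ (↑B : Set V), openEdgeCluster ω s)} ∩
        {ω : BondConfig V | (fun _ : Set (Sym2 V) => True) (⋃ t ∈ ({c} : Set V), openEdgeCluster ω t)})) = D := by
      ext ω; simp
    have e2 : (D ∩ (E ∩ {ω : BondConfig V | (fun _ : Set (Sym2 V) => True) (⋃ s ∈ (↑B : Set V), openEdgeCluster ω s)})) =
        D ∩ E := by
      ext ω; simp [hE]
    have e3 : (D ∩ (Hc ∩ {ω : BondConfig V | (fun _ : Set (Sym2 V) => True) (⋃ t ∈ ({c} : Set V), openEdgeCluster ω t)})) =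
        D ∩ Hc := by
      ext ω; simp
    rw [e1, e2, e3] at key
    exact key
  -- (2) the set champion row: `μ(D ∩ Hc) ≤ μ(D ∩ HB)`
  have h2 : μ.real (D ∩ Hc) ≤ μ.real (D ∩ HB) := by
    have os := observerSet_le_of_lonelier w A B y c hyB j hle
    -- `{c ↮ B} = D` (symmetry of `↔`)
    have hD' : ∀ ω : BondConfig V, (∀ x ∈ B, ω ∉ (openConn c x : Set (BondConfig V))) ↔ ω ∈ D := by
      intro ω
      simp only [hD, mem_setOf_eq, Finset.mem_coe, mem_singleton_iff, forall_eq]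
      exact ⟨fun h b hb hr => h b hb hr.symm, fun h x hx hr => h x hx hr.symm⟩
    -- `|π(B)| ≥ 1` always (`y ∈ B ∩ A`)
    have hge1 : ∀ ω : BondConfig V,
        1 ≤ (A.filter fun z => ∃ x ∈ B, ω ∈ (openConn x z : Set (BondConfig V))).card := fun ω =>
      Finset.card_pos.2 ⟨y, Finset.mem_filter.2 ⟨hyA, y, hyB, SimpleGraph.Reachable.refl y⟩⟩
    have hL : {ω : BondConfig V | (∀ x ∈ B, ω ∉ (openConn c x : Set (BondConfig V))) ∧
        1 ≤ (A.filter fun z => ∃ x ∈ B, ω ∈ (openConn x z : Set (BondConfig V))).card ∧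
        (A.filter fun z => ∃ x ∈ B, ω ∈ (openConn x z : Set (BondConfig V))).card ≤ j} = D \ HB := by
      ext ω
      simp only [mem_setOf_eq, Set.mem_sdiff, hHB, not_lt]
      constructor
      · rintro ⟨hd, -, hle'⟩; exact ⟨(hD' ω).1 hd, hle'⟩
      · rintro ⟨hd, hle'⟩; exact ⟨(hD' ω).2 hd, hge1 ω, hle'⟩
    have hR : {ω : BondConfig V | (∀ x ∈ B, ω ∉ (openConn c x : Set (BondConfig V))) ∧
        (A.filter fun z => ω ∈ openConn c z).card ≤ j} = D \ Hc := by
      ext ω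
      simp only [mem_setOf_eq, Set.mem_sdiff, hHc, not_lt]
      constructor
      · rintro ⟨hd, hle'⟩; exact ⟨(hD' ω).1 hd, hle'⟩
      · rintro ⟨hd, hle'⟩; exact ⟨(hD' ω).2 hd, hle'⟩
    rw [hL, hR] at os
    have a1 : μ.real (D ∩ HB) + μ.real (D \ HB) = μ.real D :=
      measureReal_inter_add_sdiff MeasurableSet.of_discrete
    have a2 : μ.real (D ∩ Hc) + μ.real (D \ Hc) = μ.real D :=
      measureReal_inter_add_sdiff MeasurableSet.of_discrete
    change μ.real (D \ HB) ≤ μ.real (D \ Hc) at os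
    linarith
  -- (3) positive correlation of `E` and `HB` (both increasing in `C_B`) given `D`
  have h3 : μ.real (D ∩ E) * μ.real (D ∩ HB) ≤ μ.real (D ∩ (E ∩ HB)) * μ.real D := by
    have key := setClusterEventExchange w (↑B : Set V) ({c} : Set V) P QB (fun _ => True) (fun _ => True)
      hP hQB_mono (fun _ _ _ h => h) (fun _ _ _ h => h)
    rw [hQB_ev] at key
    have e1 : (D ∩ (E ∩ {ω : BondConfig V | (fun _ : Set (Sym2 V) => True) (⋃ t ∈ ({c} : Set V), openEdgeCluster ω t)})) =
        D ∩ E := by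
      ext ω; simp [hE]
    have e2 : (D ∩ (HB ∩ {ω : BondConfig V | (fun _ : Set (Sym2 V) => True) (⋃ t ∈ ({c} : Set V), openEdgeCluster ω t)})) =
        D ∩ HB := by
      ext ω; simp
    have e3 : (D ∩ ({ω : BondConfig V | (fun _ : Set (Sym2 V) => True) (⋃ t ∈ ({c} : Set V), openEdgeCluster ω t)} ∩
        {ω : BondConfig V | (fun _ : Set (Sym2 V) => True) (⋃ t ∈ ({c} : Set V), openEdgeCluster ω t)})) = D := by
      ext ω; simp
    rw [e1, e2, e3] at key
    exact key
  -- assemble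
  have hgoal : μ.real (D ∩ (E ∩ Hc)) ≤ μ.real (D ∩ (E ∩ HB)) := by
    by_cases hD0 : μ.real D = 0
    · have : μ.real (D ∩ (E ∩ Hc)) ≤ μ.real D := measureReal_mono inter_subset_left (measure_ne_top _ _)
      linarith [measureReal_nonneg (μ := μ) (s := D ∩ (E ∩ HB))]
    · have hDpos : 0 < μ.real D := lt_of_le_of_ne measureReal_nonneg (Ne.symm hD0)
      have hEpos : 0 ≤ μ.real (D ∩ E) := measureReal_nonneg
      -- μ(D∩E∩Hc) μ(D) ≤ μ(D∩E) μ(D∩Hc) ≤ μ(D∩E) μ(D∩HB) ≤ μ(D∩E∩HB) μ(D)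
      have step : μ.real (D ∩ (E ∩ Hc)) * μ.real D ≤ μ.real (D ∩ (E ∩ HB)) * μ.real D :=
        calc μ.real (D ∩ (E ∩ Hc)) * μ.real D ≤ μ.real (D ∩ E) * μ.real (D ∩ Hc) := h1
          _ ≤ μ.real (D ∩ E) * μ.real (D ∩ HB) := mul_le_mul_of_nonneg_left h2 hEpos
          _ ≤ μ.real (D ∩ (E ∩ HB)) * μ.real D := h3
      exact le_of_mul_le_mul_right step hDpos
  have eL : (E ∩ {ω : BondConfig V | ∀ b ∈ B, ω ∉ (openConn b c : Set (BondConfig V))} ∩ Hc) = D ∩ (E ∩ Hc) := by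
    rw [hDeq]; ext ω; simp only [mem_inter_iff]; tauto
  have eR : (E ∩ {ω : BondConfig V | ∀ b ∈ B, ω ∉ (openConn b c : Set (BondConfig V))} ∩ HB) = D ∩ (E ∩ HB) := by
    rw [hDeq]; ext ω; simp only [mem_inter_iff]; tauto
  rw [eL, eR]
  exact hgoal

end UpwardTransport

end Summit.CriticalPhenomena.PercolationContinuityZ3.Theorems

end
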